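import Literature.Analysis.SpecialFunctions.DigammaGauss
import Mathlib.Analysis.Real.Pi.Bounds
import HarnessLib

/-!
# The digamma function on vertical lines: a logarithmic bound for `‖ψ(w)‖`

Sibling of `Literature/Analysis/SpecialFunctions/DigammaGauss.lean`, which proves the series
`ψ(w) + γ = Σ_{k ≥ 0} (1/(k+1) − 1/(w+k))` (`Literature.Analysis.SpecialFunctions.Complex.hasSum_one_div_sub_one_div_digamma`,
Andrews–Askey–Roy (1.2.13)) and the bound `|Re ψ(w) − log ‖w‖| ≤ 1/(2‖w‖²) + π/(4|Im w|)` for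
`0 < Re w`, `Im w ≠ 0`. Here we add what the contour-integral proof of the Guinand–Weil explicit
formula consumes about `ψ` on vertical lines (E. Bombieri, Rend. Lincei (9) 11 (2000), §2:
"`Γ'/Γ(w)` is of logarithmic order on vertical lines away from the poles"):

* `Literature.Analysis.SpecialFunctions.Complex.hasSum_im_digamma`, `Literature.Analysis.SpecialFunctions.Complex.abs_im_digamma_le` — `Im ψ(w) = Im w · Σ_k ‖w+k‖⁻²`
  and `|Im ψ(w)| ≤ |Im w|/‖w‖² + π/2` (`Σ_k ‖w+k‖⁻² ≤ ‖w‖⁻² + π/(2|Im w|)`,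
  `Literature.Analysis.SpecialFunctions.Complex.sum_inv_norm_add_sq_le`);
* `Literature.Analysis.SpecialFunctions.Complex.norm_digamma_le`, `Literature.Analysis.SpecialFunctions.Complex.norm_digamma_le_log` — **`‖ψ(w)‖ ≤ log(1 + ‖w‖) + 8`**
  for `0 < Re w`, `|Im w| ≥ 1/2`; and on a whole vertical line `Re w = a > 0`,
  `Literature.Analysis.SpecialFunctions.Complex.exists_norm_digamma_vertical_le`: `‖ψ(a + iy)‖ ≤ C_a + log(1 + |y|)` for all real
  `y` (continuity of `ψ` on `Re w > 0` near the real axis);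
* `Literature.Analysis.SpecialFunctions.Complex.differentiableOn_digamma`, `Literature.Analysis.SpecialFunctions.Complex.continuousOn_digamma` — set versions, on
  the open half-plane `Re w > 0`, of the pointwise `Literature.NumberTheory.LFunctions.analyticAt_digamma_of_re_pos`,
  `Literature.NumberTheory.LFunctions.continuousAt_digamma_of_re_pos`
  (`Literature/NumberTheory/LFunctions/RiemannSiegelFacts.lean`, which cannot be imported here
  without inverting the layering).

The reflection `ψ(w̄) = conj ψ(w)` is `Literature.NumberTheory.LFunctions.digamma_conj` and `Γ_ℝ'/Γ_ℝ = −½ log π + ½ ψ(s/2)` is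
`Literature.NumberTheory.LFunctions.logDeriv_Gammaℝ` / `Literature.NumberTheory.LFunctions.RealZeros.hasDerivAt_Gammaℝ` (NumberTheory layer); they are not
duplicated here. Everything here is proved; there are no named facts.

## References

* G. E. Andrews, R. Askey, R. Roy, *Special Functions*, Encyclopedia Math. Appl. 71, CUP 1999,
  §1.2, Thm. 1.2.5, (1.2.13).
* E. Bombieri, *Remarks on Weil's quadratic functional in the theory of prime numbers I*, Rend.
  Mat. Acc. Lincei (9) 11 (2000), 183–233, §2.
-/

noncomputable section

open Complex Filter Topology Set
open scoped Real ComplexConjugate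

namespace Literature.Analysis.SpecialFunctions.Complex

/-! ### The imaginary part of `ψ` and a bound for `‖ψ(w)‖` -/

/-- For `0 < Re w`: `Im ψ(w) = Im w · Σ_{k ≥ 0} 1/‖w + k‖²` (imaginary part of the series
`ψ(w) + γ = Σ (1/(k+1) − 1/(w+k))`). [cite: AndrewsAskeyRoy1999, Thm 1.2.5 (1.2.13)] -/
theorem hasSum_im_digamma {w : ℂ} (hw : 0 < w.re) :
    HasSum (fun k : ℕ ↦ w.im / ‖w + k‖ ^ 2) (digamma w).im := by
  have h := Complex.hasSum_im (hasSum_one_div_sub_one_div_digamma hw)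
  simp only [add_im, ofReal_im, add_zero] at h
  refine h.congr_fun fun k ↦ ?_
  have hk : ((1 : ℂ) / ((k : ℂ) + 1)).im = 0 := by
    rw [show (k : ℂ) + 1 = ((k + 1 : ℝ) : ℂ) by push_cast; ring, ← ofReal_one, ← ofReal_div,
      ofReal_im]
  rw [sub_im, hk, zero_sub, one_div, inv_im, neg_div, neg_neg, Complex.normSq_eq_norm_sq]
  simp

/-- For `0 < Re w`: `Σ_{k ≥ 0} 1/‖w + k‖² ≤ 1/‖w‖² + π/(2|Im w|)` (`Im w ≠ 0`). [folklore] -/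
theorem tsum_inv_norm_add_sq_le {w : ℂ} (hw : 0 < w.re) (hy : w.im ≠ 0) :
    ∑' k : ℕ, 1 / ‖w + k‖ ^ 2 ≤ 1 / ‖w‖ ^ 2 + π / (2 * |w.im|) :=
  Real.tsum_le_of_sum_range_le (fun _ ↦ by positivity) (sum_inv_norm_add_sq_le hw hy)

/-- **`|Im ψ(w)| ≤ |Im w|/‖w‖² + π/2`** for `0 < Re w`, `Im w ≠ 0`. [folklore] -/
theorem abs_im_digamma_le {w : ℂ} (hw : 0 < w.re) (hy : w.im ≠ 0) :
    |(digamma w).im| ≤ |w.im| / ‖w‖ ^ 2 + π / 2 := by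
  have hs := hasSum_im_digamma hw
  rw [← hs.tsum_eq]
  have e : (fun k : ℕ ↦ w.im / ‖w + k‖ ^ 2) = fun k : ℕ ↦ w.im * (1 / ‖w + k‖ ^ 2) := by
    funext k; ring
  rw [e, tsum_mul_left, abs_mul]
  have h0 : 0 ≤ ∑' k : ℕ, 1 / ‖w + (k : ℂ)‖ ^ 2 := tsum_nonneg fun _ ↦ by positivity
  rw [abs_of_nonneg h0]
  have hy' : 0 < |w.im| := abs_pos.2 hy
  calc |w.im| * ∑' k : ℕ, 1 / ‖w + (k : ℂ)‖ ^ 2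
      ≤ |w.im| * (1 / ‖w‖ ^ 2 + π / (2 * |w.im|)) :=
        mul_le_mul_of_nonneg_left (tsum_inv_norm_add_sq_le hw hy) (abs_nonneg _)
    _ = |w.im| / ‖w‖ ^ 2 + π / 2 := by field_simp

/-- `‖ψ(w)‖ ≤ |log ‖w‖| + 1/(2‖w‖²) + π/(4|Im w|) + |Im w|/‖w‖² + π/2` for `0 < Re w`, `Im w ≠ 0`
(`‖z‖ ≤ |Re z| + |Im z|`, `abs_re_digamma_sub_log_norm_le`, `abs_im_digamma_le`). [folklore] -/
theorem norm_digamma_le {w : ℂ} (hw : 0 < w.re) (hy : w.im ≠ 0) :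
    ‖digamma w‖ ≤ |Real.log ‖w‖| + 1 / (2 * ‖w‖ ^ 2) + π / (4 * |w.im|) +
      (|w.im| / ‖w‖ ^ 2 + π / 2) := by
  have h1 := abs_re_digamma_sub_log_norm_le hw hy
  have h2 := abs_im_digamma_le hw hy
  have h3 := Complex.norm_le_abs_re_add_abs_im (digamma w)
  have h4 : |(digamma w).re| ≤ |Real.log ‖w‖| + (1 / (2 * ‖w‖ ^ 2) + π / (4 * |w.im|)) := by
    have := abs_sub_abs_le_abs_sub (digamma w).re (Real.log ‖w‖)
    linarith
  linarith

/-- **Logarithmic bound on vertical strips**: for `0 < Re w` and `|Im w| ≥ 1/2`,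
`‖ψ(w)‖ ≤ log(1 + ‖w‖) + 8`. [folklore] -/
theorem norm_digamma_le_log {w : ℂ} (hw : 0 < w.re) (hy : 1 / 2 ≤ |w.im|) :
    ‖digamma w‖ ≤ Real.log (1 + ‖w‖) + 8 := by
  have hy0 : w.im ≠ 0 := by
    intro h; rw [h, abs_zero] at hy; norm_num at hy
  have hw2 : 1 / 2 ≤ ‖w‖ := hy.trans (Complex.abs_im_le_norm w)
  have hwpos : 0 < ‖w‖ := by linarith
  have h := norm_digamma_le hw hy0
  -- the five terms
  have t1 : |Real.log ‖w‖| ≤ Real.log (1 + ‖w‖) + Real.log 2 := by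
    rcases le_or_gt 1 ‖w‖ with h1 | h1
    · rw [abs_of_nonneg (Real.log_nonneg h1)]
      have := Real.log_le_log hwpos (by linarith : ‖w‖ ≤ 1 + ‖w‖)
      linarith [Real.log_nonneg (by norm_num : (1 : ℝ) ≤ 2)]
    · rw [abs_of_neg (Real.log_neg hwpos h1)]
      have h2 : -Real.log ‖w‖ ≤ Real.log 2 := by
        rw [← Real.log_inv]
        exact Real.log_le_log (by positivity) (by rw [inv_le_comm₀ hwpos two_pos]; linarith)
      linarith [Real.log_nonneg (by linarith : (1 : ℝ) ≤ 1 + ‖w‖)]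
  have t2 : 1 / (2 * ‖w‖ ^ 2) ≤ 2 := by
    rw [div_le_iff₀ (by positivity)]; nlinarith
  have t3 : π / (4 * |w.im|) ≤ π / 2 :=
    div_le_div_of_nonneg_left Real.pi_pos.le two_pos (by linarith)
  have t4 : |w.im| / ‖w‖ ^ 2 ≤ 2 := by
    rw [div_le_iff₀ (by positivity)]
    nlinarith [Complex.abs_im_le_norm w]
  have hlog2 : Real.log 2 < 0.6931471808 := Real.log_two_lt_d9
  have hpi : π < 3.15 := Real.pi_lt_d2
  linarith

/-! ### Regularity of `ψ` on the right half-plane -/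

/-- `Γ` is differentiable on the open right half-plane (set version of the pointwise
`Literature.NumberTheory.LFunctions.analyticAt_Gamma_of_re_pos`, `RiemannSiegelFacts.lean`). [folklore] -/
theorem differentiableOn_Gamma_re_pos : DifferentiableOn ℂ Gamma {w : ℂ | 0 < w.re} :=
  fun w hw ↦ (Complex.differentiableAt_Gamma w fun m h ↦ by
    have : (w.re : ℝ) = -m := by rw [h]; simp
    have hw' : (0 : ℝ) < w.re := hw
    linarith [this, (Nat.cast_nonneg m : (0 : ℝ) ≤ m)]).differentiableWithinAt

/-- **`ψ` is holomorphic on `Re w > 0`** (`ψ = Γ'/Γ`, `Γ` holomorphic and zero-free there; set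
version of the pointwise `Literature.NumberTheory.LFunctions.analyticAt_digamma_of_re_pos`, `RiemannSiegelFacts.lean`).
[folklore] -/
theorem differentiableOn_digamma : DifferentiableOn ℂ digamma {w : ℂ | 0 < w.re} := by
  have hG := differentiableOn_Gamma_re_pos
  have hG' : DifferentiableOn ℂ (deriv Gamma) {w : ℂ | 0 < w.re} :=
    (hG.analyticOnNhd (isOpen_lt continuous_const Complex.continuous_re)).deriv.differentiableOn
  have : digamma = fun w ↦ deriv Gamma w / Gamma w := by
    funext w; rw [digamma_def, logDeriv_apply]
  rw [this]
  exact hG'.div hG fun w hw ↦ Complex.Gamma_ne_zero_of_re_pos hw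

/-- `ψ` is continuous on `Re w > 0` (set version of the pointwise
`Literature.NumberTheory.LFunctions.continuousAt_digamma_of_re_pos`, `RiemannSiegelFacts.lean`). [folklore] -/
theorem continuousOn_digamma : ContinuousOn digamma {w : ℂ | 0 < w.re} :=
  differentiableOn_digamma.continuousOn

/-- **`ψ` on a vertical line `Re w = a > 0`**: there is `C = C(a)` with
`‖ψ(a + iy)‖ ≤ C + log(1 + |y|)` for every real `y` (`norm_digamma_le_log` for `|y| ≥ 1/2`,
continuity on the compact segment `|y| ≤ 1/2`). [folklore] -/
theorem exists_norm_digamma_vertical_le {a : ℝ} (ha : 0 < a) :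
    ∃ C : ℝ, ∀ y : ℝ, ‖digamma (a + y * I)‖ ≤ C + Real.log (1 + |y|) := by
  -- compact segment
  set K : Set ℂ := (fun y : ℝ ↦ (a : ℂ) + y * I) '' Icc (-(1 / 2 : ℝ)) (1 / 2)
  have hKc : IsCompact K := (isCompact_Icc).image (by fun_prop)
  have hKsub : K ⊆ {w : ℂ | 0 < w.re} := by
    rintro _ ⟨y, -, rfl⟩; simpa using ha
  obtain ⟨M, hM⟩ := hKc.exists_bound_of_continuousOn (continuousOn_digamma.mono hKsub)
  refine ⟨max M (Real.log (1 + a) + 8), fun y ↦ ?_⟩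
  have hlog0 : 0 ≤ Real.log (1 + |y|) := Real.log_nonneg (by linarith [abs_nonneg y])
  rcases le_or_gt (1 / 2 : ℝ) |y| with hy | hy
  · have hw : 0 < ((a : ℂ) + y * I).re := by simpa using ha
    have hyi : 1 / 2 ≤ |((a : ℂ) + y * I).im| := by simpa using hy
    have h := norm_digamma_le_log hw hyi
    have hn : ‖(a : ℂ) + y * I‖ ≤ a + |y| := by
      refine (norm_add_le _ _).trans ?_
      simp [abs_of_pos ha]
    have hl : Real.log (1 + ‖(a : ℂ) + y * I‖) ≤ Real.log (1 + a) + Real.log (1 + |y|) := by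
      rw [← Real.log_mul (by positivity) (by positivity)]
      refine Real.log_le_log (by positivity) ?_
      nlinarith [abs_nonneg y, norm_nonneg ((a : ℂ) + y * I)]
    calc ‖digamma (a + y * I)‖ ≤ Real.log (1 + a) + 8 + Real.log (1 + |y|) := by linarith
      _ ≤ max M (Real.log (1 + a) + 8) + Real.log (1 + |y|) := by
          gcongr; exact le_max_right _ _
  · have hyK : (a : ℂ) + y * I ∈ K :=
      ⟨y, ⟨by linarith [(abs_lt.1 hy).1], (abs_lt.1 hy).2.le⟩, rfl⟩
    calc ‖digamma (a + y * I)‖ ≤ M := hM _ hyK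
      _ ≤ max M (Real.log (1 + a) + 8) + Real.log (1 + |y|) := by
          linarith [le_max_left M (Real.log (1 + a) + 8)]

end Literature.Analysis.SpecialFunctions.Complex

end
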